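import Mathlib
import Summits.ValiantsHypothesis.ValiantsHypothesis.Theorems.BarrierLeverDcSliceCoversVP
import Summits.ValiantsHypothesis.ValiantsHypothesis.Theorems.BarrierLeverDefinableEquationsPartialDerivativeWall
import Summits.ValiantsHypothesis.ValiantsHypothesis.Theorems.BarrierLeverDefinableEquationsFullRankMethodWall
import Summits.ValiantsHypothesis.ValiantsHypothesis.Theorems.BarrierLeverDefinableEquationsProductDepthWall

/-!
# Route BarrierLever — support item `DefinableDcEquations` (stmt-8746): the METHOD WALLS of the
# crux hold on the DETERMINANTAL slices too (val-np-p5 g10)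

Item 8746 asks for level-`a` Boolean-sum equations of the classes
`𝒟𝒞_m(n) = {f ∈ ℂ[x_1..x_n] : deg f ≤ n, dc(f) ≤ m(n)}` for a threshold function `m` that is
SUPER-QUASI-POLYNOMIAL: `∀ C ∃ n₀ ∀ n ≥ n₀, 2^{C (log₂ n + 1)²} ≤ m(n)` (the growth clause of the
route decl `DefinableDcEquations`).  By VSBR depth reduction (tree
`determinantalComplexity_le_two_pow`: `dc(f) ≤ 2^{17 E²}` for `deg f, L(f) ≤ 2^E`) every such slice
eventually swallows `SmallCircuits ℂ n b` for each `b` (`smallCircuits_subset_dcSlice`, from the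
tree's `determinantalComplexity_le_of_mem_smallCircuits` of the proved `DcSliceCoversVP`).  Consequently each method wall of
the crux (`…PartialDerivativeWall`, `…FullRankMethodWall`, `…ProductDepthWall`) transfers verbatim
to the classes of 8746, for EVERY admissible threshold `m`, eventually in `n`:

* `pd_sublevel_eq_univ_of_dcSlice`, `distinguisher_eq_zero_of_pdRankSublevel_dcSlice`: a
  partial-derivative rank threshold `{rank f_{e,·} < r}` (`e ≤ n/2`) containing `𝒟𝒞_m(n)` is
  everything, and a polynomial in the coefficient variables cutting it out and vanishing on
  `𝒟𝒞_m(n)` is zero;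
* `exists_isFullRank_dcSlice`: `𝒟𝒞_m(2n)` contains a FULL-RANK polynomial (the specialised
  Raz–Yehudayoff polynomial), so no full-rank certificate vanishes on it
  (`no_fullRankCertificate_dcSlice`);
* `exists_fullPdRank_dcSlice`: for every LST word datum, `𝒟𝒞_m(n)` contains a polynomial of full
  block rank, so the LST class condition fails on it (`not_forall_pdRank_lt_dcSlice`).

Reading: the rank-4 support item is, like the crux, out of reach of every classical rank method —
its intended witnesses (highest-weight vectors of `I(Δ(det_m))`, GCT) are of a different nature.
What this is NOT: nothing on the item's truth (OPEN; the dc axis of the tree stands at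
`m(n) = n + Θ(a·n/log n)`, val-np-p5 g0–g2) or on `VP ≠ VNP`.  No definitions, no named facts,
standard axioms (imports `…DcSliceCoversVP`, hence the route file).  Refs: Bürgisser–Clausen–Shokrollahi 1997 Thm. 21.36; Forbes–Shpilka–Volk 2018.
-/

-- `Summit.ValiantsHypothesis.ValiantsHypothesis.…` repeats a component by the D-0017 layout
-- (single-conjunct summit), which the `dupNamespace` linter flags; the name is mandated.
set_option linter.dupNamespace false

noncomputable section

namespace Summit.ValiantsHypothesis.ValiantsHypothesis.Theorems.BarrierLeverDefinableEquations

open MvPolynomial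
open Literature.Computability.AlgebraicComplexity hiding IsSyntacticallyMultilinear smCircuitSize
open Literature.Computability.AlgebraicComplexity.LSTWord
open Literature.Barriers.ValiantsHypothesis
open scoped BigOperators

namespace DcSliceWalls

/-! ## §1 The determinantal slice swallows `SmallCircuits ℂ n b` -/

/-- **Every admissible determinantal slice eventually contains `SmallCircuits ℂ n b`.**  For a
threshold `m` with the growth clause of `DefinableDcEquations` and every `b` there is `n₀` with
`SmallCircuits ℂ n b ⊆ {f : deg f ≤ n, dc(f) ≤ m(n)}` for all `n ≥ n₀`. [cite: BurgisserClausenShokrollahi1997, Thm. 21.36] -/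
theorem smallCircuits_subset_dcSlice (m : ℕ → ℕ)
    (hm : ∀ C : ℕ, ∃ n₀ : ℕ, ∀ n ≥ n₀, 2 ^ (C * (Nat.log 2 n + 1) ^ 2) ≤ m n) (b : ℕ) :
    ∃ n₀ : ℕ, ∀ n ≥ n₀, SmallCircuits ℂ n b ⊆
      {f : MvPolynomial (Fin n) ℂ | f.totalDegree ≤ n ∧ determinantalComplexity f ≤ m n} := by
  obtain ⟨n₀, hn₀⟩ := hm (17 * max b 1 ^ 2)
  refine ⟨n₀, fun n hn f hf => ⟨hf.1, ?_⟩⟩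
  exact (Summit.ValiantsHypothesis.ValiantsHypothesis.Theorems.determinantalComplexity_le_of_mem_smallCircuits
    hf).trans (hn₀ n hn)

/-! ## §2 The partial-derivative wall on the determinantal slices -/

/-- For every admissible `m`, eventually in `n`: a PD-rank threshold `{rank g_{e,·} < r}`
(`e ≤ n/2`) containing the slice `{deg ≤ n, dc ≤ m(n)}` is everything. [cite: GesmundoLandsberg2017, Thm. 4] -/
theorem pd_sublevel_eq_univ_of_dcSlice (m : ℕ → ℕ)
    (hm : ∀ C : ℕ, ∃ n₀ : ℕ, ∀ n ≥ n₀, 2 ^ (C * (Nat.log 2 n + 1) ^ 2) ≤ m n) :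
    ∃ n₀ : ℕ, ∀ n ≥ n₀, ∀ e r : ℕ, e ≤ n / 2 →
      {f : MvPolynomial (Fin n) ℂ | f.totalDegree ≤ n ∧ determinantalComplexity f ≤ m n} ⊆
        {g : MvPolynomial (Fin n) ℂ | shiftedPartialsRank ℂ e 0 g < r} →
      {g : MvPolynomial (Fin n) ℂ | shiftedPartialsRank ℂ e 0 g < r} = Set.univ := by
  obtain ⟨n₀, hn₀⟩ := smallCircuits_subset_dcSlice m hm 2
  refine ⟨max n₀ 3, fun n hn e r he h => ?_⟩
  exact PartialDerivativeWall.sublevel_eq_univ_of_smallCircuits (b := 2)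
    (le_trans (le_max_right _ _) hn) le_rfl he ((hn₀ n (le_trans (le_max_left _ _) hn)).trans h)

/-- FSV form: for every admissible `m`, eventually in `n`, a polynomial `D` in the coefficient
variables whose zero set on degree-`≤ n` coefficient vectors is a PD-rank threshold (`e ≤ n/2`) and
which vanishes on `{deg ≤ n, dc ≤ m(n)}` is the ZERO polynomial. [cite: ForbesShpilkaVolk2018, Def. 1] -/
theorem distinguisher_eq_zero_of_pdRankSublevel_dcSlice (m : ℕ → ℕ)
    (hm : ∀ C : ℕ, ∃ n₀ : ℕ, ∀ n ≥ n₀, 2 ^ (C * (Nat.log 2 n + 1) ^ 2) ≤ m n) :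
    ∃ n₀ : ℕ, ∀ n ≥ n₀, ∀ (e r : ℕ), e ≤ n / 2 → ∀ D : MvPolynomial (degLEMonomials n) ℂ,
      (∀ f : MvPolynomial (Fin n) ℂ, f.totalDegree ≤ n →
        (eval (coeffVector (degLEMonomials n) f) D = 0 ↔ shiftedPartialsRank ℂ e 0 f < r)) →
      (∀ f : MvPolynomial (Fin n) ℂ, f.totalDegree ≤ n → determinantalComplexity f ≤ m n →
        eval (coeffVector (degLEMonomials n) f) D = 0) →
      D = 0 := by
  obtain ⟨n₀, hn₀⟩ := smallCircuits_subset_dcSlice m hm 2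
  refine ⟨max n₀ 3, fun n hn e r he D hD hvan => ?_⟩
  refine PartialDerivativeWall.distinguisher_eq_zero_of_pdRankSublevel (b := 2)
    (le_trans (le_max_right _ _) hn) le_rfl he D hD fun f hf => ?_
  obtain ⟨hdeg, hdc⟩ := hn₀ n (le_trans (le_max_left _ _) hn) hf
  exact hvan f hdeg hdc

/-! ## §3 The full-rank wall on the determinantal slices (`2n` variables) -/

/-- For every admissible `m`, eventually in `n`: the slice `{deg ≤ 2n, dc ≤ m(2n)}` in `2n`
variables contains a polynomial of FULL RANK. [cite: RazYehudayoff2008, Thm. 4.2 and Thm. 4.4] -/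
theorem exists_isFullRank_dcSlice (m : ℕ → ℕ)
    (hm : ∀ C : ℕ, ∃ n₀ : ℕ, ∀ n ≥ n₀, 2 ^ (C * (Nat.log 2 n + 1) ^ 2) ≤ m n) :
    ∃ n₀ : ℕ, ∀ n ≥ n₀, ∃ g : MvPolynomial (Fin (2 * n)) ℂ,
      g.totalDegree ≤ 2 * n ∧ determinantalComplexity g ≤ m (2 * n) ∧ IsFullRank n g := by
  obtain ⟨n₀, hn₀⟩ := smallCircuits_subset_dcSlice m hm 3
  refine ⟨max n₀ 2, fun n hn => ?_⟩
  obtain ⟨g, hg, hfull⟩ := FullRankMethodWall.exists_isFullRank_smallCircuits (n := n) (b := 3)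
    (le_trans (le_max_right _ _) hn) le_rfl
  obtain ⟨hdeg, hdc⟩ := hn₀ (2 * n) (by omega) hg
  exact ⟨g, hdeg, hdc, hfull⟩

/-- Hence no full-rank certificate — a polynomial in the coefficient variables nonzero at every
full-rank polynomial of degree `≤ 2n` — vanishes on the slice `{deg ≤ 2n, dc ≤ m(2n)}`, eventually.
[cite: ForbesShpilkaVolk2018, Def. 1] -/
theorem no_fullRankCertificate_dcSlice (m : ℕ → ℕ)
    (hm : ∀ C : ℕ, ∃ n₀ : ℕ, ∀ n ≥ n₀, 2 ^ (C * (Nat.log 2 n + 1) ^ 2) ≤ m n) :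
    ∃ n₀ : ℕ, ∀ n ≥ n₀, ¬ ∃ D : MvPolynomial (degLEMonomials (2 * n)) ℂ,
      (∀ g : MvPolynomial (Fin (2 * n)) ℂ, g.totalDegree ≤ 2 * n → IsFullRank n g →
        eval (coeffVector (degLEMonomials (2 * n)) g) D ≠ 0) ∧
      ∀ f : MvPolynomial (Fin (2 * n)) ℂ, f.totalDegree ≤ 2 * n →
        determinantalComplexity f ≤ m (2 * n) → eval (coeffVector (degLEMonomials (2 * n)) f) D = 0 := by
  obtain ⟨n₀, hn₀⟩ := exists_isFullRank_dcSlice m hm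
  refine ⟨n₀, fun n hn ⟨D, hsound, hvan⟩ => ?_⟩
  obtain ⟨g, hdeg, hdc, hfull⟩ := hn₀ n hn
  exact hsound g hdeg hfull (hvan g hdeg hdc)

/-! ## §4 The LST wall on the determinantal slices -/

/-- For every admissible `m`, eventually in `n`: for every word datum (`1 ≤ d ≤ n`, states fitting
into `Fin n`) and every embedding of its blocks, the slice `{deg ≤ n, dc ≤ m(n)}` contains a
polynomial of FULL block rank. [cite: LimayeSrinivasanTavenas2025, §2.2 and Lemma 8] -/
theorem exists_fullPdRank_dcSlice (m : ℕ → ℕ)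
    (hm : ∀ C : ℕ, ∃ n₀ : ℕ, ∀ n ≥ n₀, 2 ^ (C * (Nat.log 2 n + 1) ^ 2) ≤ m n) :
    ∃ n₀ : ℕ, ∀ n ≥ n₀, ∀ {d : ℕ} (k : ℕ) (pos : Fin d → Bool), 1 ≤ d → d ≤ n →
      (hn : ∀ t ≤ d, 2 ^ overLen k pos t ≤ n) → ∀ e : (Σ i : Fin d, BlockVar k pos i) ↪ Fin n,
      ∃ f : MvPolynomial (Fin n) ℂ, f.totalDegree ≤ n ∧ determinantalComplexity f ≤ m n ∧
        pdRank ℂ (posBlocks pos) (negBlocks pos) (killCompl e.injective f) =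
          2 ^ min (streamLen k pos true d) (streamLen k pos false d) := by
  obtain ⟨n₀, hn₀⟩ := smallCircuits_subset_dcSlice m hm 5
  refine ⟨max n₀ 4, fun n hn d k pos hd hdn hn' e => ?_⟩
  obtain ⟨f, hf, hrk⟩ := ProductDepthWall.exists_fullPdRank_smallCircuits k pos
    (le_trans (le_max_right _ _) hn) hd hdn hn' e
  obtain ⟨hdeg, hdc⟩ := hn₀ n (le_trans (le_max_left _ _) hn) hf
  exact ⟨f, hdeg, hdc, hrk⟩

/-- Hence the LST class condition `pdRank < 2^{min}` fails on the slice `{deg ≤ n, dc ≤ m(n)}`,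
eventually in `n`, for every word datum and embedding. [cite: LimayeSrinivasanTavenas2025, §2.2] -/
theorem not_forall_pdRank_lt_dcSlice (m : ℕ → ℕ)
    (hm : ∀ C : ℕ, ∃ n₀ : ℕ, ∀ n ≥ n₀, 2 ^ (C * (Nat.log 2 n + 1) ^ 2) ≤ m n) :
    ∃ n₀ : ℕ, ∀ n ≥ n₀, ∀ {d : ℕ} (k : ℕ) (pos : Fin d → Bool), 1 ≤ d → d ≤ n →
      (hn : ∀ t ≤ d, 2 ^ overLen k pos t ≤ n) → ∀ e : (Σ i : Fin d, BlockVar k pos i) ↪ Fin n,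
      ¬ ∀ f : MvPolynomial (Fin n) ℂ, f.totalDegree ≤ n → determinantalComplexity f ≤ m n →
        pdRank ℂ (posBlocks pos) (negBlocks pos) (killCompl e.injective f) <
          2 ^ min (streamLen k pos true d) (streamLen k pos false d) := by
  obtain ⟨n₀, hn₀⟩ := exists_fullPdRank_dcSlice m hm
  refine ⟨n₀, fun n hn d k pos hd hdn hn' e h => ?_⟩
  obtain ⟨f, hdeg, hdc, hrk⟩ := hn₀ n hn k pos hd hdn hn' e
  exact absurd (h f hdeg hdc) (by rw [hrk]; exact lt_irrefl _)

end DcSliceWalls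

end Summit.ValiantsHypothesis.ValiantsHypothesis.Theorems.BarrierLeverDefinableEquations
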